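import Literature.MathematicalPhysics.QuantumFieldTheory.Balaban1983to89.B13OpsYPencilTransport

/-!
# `Balaban1983to89.B13TaxiPathBoundsLocal` — T. Bałaban, *Propagators for lattice gauge theories in a background field*, Commun. Math. Phys. **99** (1985)
389–434 [Balaban1985BackgroundPropagators], (3.3) pp. 390–391 («U(x,x′) = U(b₁)U(b₂)⋯U(bₙ)» along a contour), (3.5) p. 391 (reversed bonds), (3.40) p. 397 («Γ_{x,x′}
a shortest contour connecting points x and x′»), (3.35)–(3.37) p. 396 (the bounds on the background hold CUBE BY CUBE, at the scale `Lʲη` of the cube's index);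
*Averaging operations for lattice gauge theories*, Commun. Math. Phys. **98** (1985) 17–51 [Balaban1985Averaging] (52)–(55) pp. 27–28: REGION-LOCAL WORD-LENGTH
BOUNDS FOR node00-def-Y's TAXICAB TRANSPORTERS — `‖U(Γ_{x,x′})^{±1}‖ ≤ K^{|x − x′|₁}` from a bound `‖U(b)^{±1}‖ ≤ K` on the bonds based in a REGION `S` that is
star-shaped for the taxicab legs towards `x′`, for an ARBITRARY configuration `U` (no pencil).

statement-level bookkeeping over node00-def-Y's `Node00/OpsYTransport` recursion (`parFwdV ∕ parBwdV ∕ taxiLegV ∕ taxiRun ∕ parTaxiV`) and dag-n10-c's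
`B13OpsYPencilTransport` algebra, with citation tags; kernel-checked; [folklore] induction on the word length; nothing here is a claim about the Yang–Mills mass gap;
nothing of Bałaban's is asserted; no node is discharged; count-neutral.

WHY THIS FILE (cell `pub-ymgap`, HUMAN RULING D-0062, Track A node N10 = [Balaban1988RG2Cluster] → N06 row 17; width seat `pub-ymgap-dag-n10-w3` g5; station W1 of the
located road's k-uniform re-read, design note bus 2026-08-28 I.38899, lane concurrence I.38020).  Every pencil letter of the N10 road (modules 73∕75∕76∕78, the local-cube
road L1–L5) bounds a transporter along `n` bonds by `(K₀e^{|η|Rc})ⁿ` from the GLOBAL chart radius `Rc` (`B13OpsYPencilTransport.norm_parTaxiV_prodCfg_le`), which forces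
`|η|·Rc ≲ 1∕D`, `D = 2(d+1)(L^k − 1)` — a radius scaled by the TOP level `k`, whereas (3.35)–(3.37) weigh the background by the LOCAL scale `(Lʲη)⁻¹` of each cube
(LOCATED (c), I.38012).  The k-uniform editions — a (3.37)-scaled pencil, or a pencil restricted to the neighbourhood of one cube by node00-def-Y's locality
`OpsYDeltaALocalAgree` — need the word-length bound with a bound on the bonds the contour actually VISITS, not on all bonds.  This file proves it for any
configuration `U` and any region `S` that contains, with a point, the taxicab legs from it towards `x′` (`S` «taxi-star-shaped towards `x′`», two displayed
clauses); `S = univ` recovers the global bound for an arbitrary `U` (itself new: the tree's version is pencil-specific).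

WHAT THIS FILE PROVES (all `theorem`s; no `def`, no instance, no notation; `U : CfgV1 P 𝔸` arbitrary, `𝔸` a complete normed `ℂ`-algebra with `‖1‖ = 1`).
§1 STRAIGHT LEGS IN A REGION: `norm_parFwdV_le_pow_of_mem` (the `n` base points `x + te_μ`, `t < n`, lie in `S` and `‖U_μ(y)‖ ≤ K` on `S` ⟹ `‖U(Γ)‖ ≤ Kⁿ`),
   `norm_parFwdV_inv_le_pow_of_mem`, `norm_parBwdV_le_pow_of_mem` (base points `x − (t+1)e_μ`), `norm_parBwdV_inv_le_pow_of_mem`.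
§2 LEGS AND RUNS IN A TAXI-STAR-SHAPED REGION (clauses `hSf ∕ hSb`: from every `y ∈ S` the leg towards `x′_μ` the shorter way round stays in `S`, endpoint included):
   `taxiLegV_fst_mem_of_starShaped`, ★ `norm_taxiLegV_le_pow_of_starShaped` (+ `_inv_`), ★★ `norm_taxiRun_le_pow_of_starShaped` (+ `_inv_`: distinct directions `l`,
   exponent `Σ_{μ∈l} min((x′_μ − y_μ).val, (y_μ − x′_μ).val)`), ★★★ `norm_parTaxiV_le_pow_of_starShaped` (+ `_inv_`: `‖U(Γ_{x,x′})^{±1}‖ ≤ K^{|x − x′|₁}` for `x ∈ S`).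
§3 THE GLOBAL COROLLARY (`S = univ`): `norm_parTaxiV_le_pow` (+ `_inv_`) — any configuration with `‖U(b)^{±1}‖ ≤ K`.
HONEST FRAMING: [folklore] word-length bookkeeping; which regions are taxi-star-shaped (boxes containing `x′` of side below half the period) and which per-bond
bounds hold there ((3.35)–(3.37) per cube, the scaled pencil) are the NEXT stations' content, displayed here; nothing of Bałaban's asserted; N06 ∕ N10 NOT discharged;
no registered stub proved; counts unmoved; one finite 𝕋⁴ programme at fixed ε — R4 closes the conditional finite-𝕋⁴ rung `BalabanLadder.UV` only; nothing continuum
∕ ℝ⁴ ∕ OS ∕ mass gap ∕ Clay.  0 `sorry`, 0 `def`, standard axioms.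

References: [Balaban1985BackgroundPropagators] (3.3) pp.390–391, (3.5) p.391, (3.35)–(3.37) p.396, (3.40) p.397, Thm 3.4 p.400; [Balaban1985Averaging] (52)–(55) pp.27–28;
[Balaban1988RG2Cluster] (2.5) p.12, p.15.
-/

noncomputable section

namespace Literature.MathematicalPhysics.QuantumFieldTheory.Balaban1983to89.B13TaxiPathBoundsLocal

open Set
open Literature.MathematicalPhysics.QuantumFieldTheory.Balaban1983to89
open Literature.MathematicalPhysics.QuantumFieldTheory.Balaban1983to89.B9BackgroundsKLevelV1 (CfgV1)
open Literature.MathematicalPhysics.QuantumFieldTheory.Balaban1983to89.Node00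
  (parFwdV parBwdV parFwdV_succ parBwdV_succ taxiLegV taxiRun parTaxiV taxiLegV_fst_apply)
open Literature.MathematicalPhysics.QuantumFieldTheory.Balaban1983to89.B13OpsYPencilTransport
  (val_inv_parFwdV_succ val_inv_parBwdV_succ taxiRun_snd_mul_and_fst_eq taxiLegV_fst_eq sum_finRange_min_eq_tdist)

variable {𝔸 : Type} [NormedRing 𝔸] [NormedAlgebra ℂ 𝔸] [CompleteSpace 𝔸] [NormOneClass 𝔸]
variable {P : Params}

/-! ## §0. Plumbing -/

omit [NormedAlgebra ℂ 𝔸] [CompleteSpace 𝔸] [NormOneClass 𝔸] in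
/-- `‖a·b‖ ≤ K·Kⁿ = K^{n+1}` from `‖a‖ ≤ K`, `‖b‖ ≤ Kⁿ`. [folklore] -/
private theorem norm_mul_le_pow_succ {a b : 𝔸} {K : ℝ} {n : ℕ} (ha : ‖a‖ ≤ K) (hb : ‖b‖ ≤ K ^ n) : ‖a * b‖ ≤ K ^ (n + 1) := by
  have h0 : 0 ≤ K := (norm_nonneg _).trans ha
  rw [pow_succ']
  exact (norm_mul_le _ _).trans (mul_le_mul ha hb (norm_nonneg _) h0)

omit [NormedAlgebra ℂ 𝔸] [CompleteSpace 𝔸] [NormOneClass 𝔸] in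
/-- `‖b·a‖ ≤ Kⁿ·K = K^{n+1}` from `‖b‖ ≤ Kⁿ`, `‖a‖ ≤ K`. [folklore] -/
private theorem norm_mul_le_pow_succ' {a b : 𝔸} {K : ℝ} {n : ℕ} (hb : ‖b‖ ≤ K ^ n) (ha : ‖a‖ ≤ K) : ‖b * a‖ ≤ K ^ (n + 1) := by
  have h0 : 0 ≤ K := (norm_nonneg _).trans ha
  rw [pow_succ]
  exact (norm_mul_le _ _).trans (mul_le_mul hb ha (norm_nonneg _) (pow_nonneg h0 n))

/-! ## §1. Straight legs whose bonds are based in a region -/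

section Straight

variable (U : CfgV1 P 𝔸) (S : Set (Site P 0)) {K : ℝ}

omit [NormedAlgebra ℂ 𝔸] [CompleteSpace 𝔸] in
/-- **FORWARD CONTOUR OF `n` BONDS BASED IN `S`**: if `‖U_μ(y)‖ ≤ K` for `y ∈ S` and the base points `x + t·e_μ`, `t < n`, lie in `S`, then `‖U(Γ)‖ ≤ Kⁿ`.
[cite: Balaban1985BackgroundPropagators, (3.3) p.391, (3.40) p.397] -/
theorem norm_parFwdV_le_pow_of_mem (hK : ∀ μ y, y ∈ S → ‖(U μ y : 𝔸)‖ ≤ K) (μ : Fin P.d) (n : ℕ) :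
    ∀ x : Site P 0, (∀ t, t < n → (fun y : Site P 0 => y.shift μ)^[t] x ∈ S) → ‖(parFwdV U μ n x : 𝔸)‖ ≤ K ^ n := by
  induction n with
  | zero => intro x _; simp
  | succ n ih =>
    intro x hx
    rw [parFwdV_succ, Units.val_mul]
    have h0 : x ∈ S := by simpa using hx 0 (Nat.succ_pos n)
    refine norm_mul_le_pow_succ (hK μ x h0) (ih (x.shift μ) fun t ht => ?_)
    have := hx (t + 1) (by omega)
    rwa [Function.iterate_succ_apply] at this

/-- … and `‖U(Γ)⁻¹‖ ≤ Kⁿ` from `‖U_μ(y)⁻¹‖ ≤ K` on `S`. [cite: Balaban1985BackgroundPropagators, (3.3), (3.5) p.391, (3.40) p.397] -/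
theorem norm_parFwdV_inv_le_pow_of_mem (hKi : ∀ μ y, y ∈ S → ‖(((U μ y)⁻¹ : 𝔸ˣ) : 𝔸)‖ ≤ K) (μ : Fin P.d) (n : ℕ) :
    ∀ x : Site P 0, (∀ t, t < n → (fun y : Site P 0 => y.shift μ)^[t] x ∈ S) → ‖(((parFwdV U μ n x)⁻¹ : 𝔸ˣ) : 𝔸)‖ ≤ K ^ n := by
  induction n with
  | zero => intro x _; simp
  | succ n ih =>
    intro x hx
    rw [val_inv_parFwdV_succ]
    have h0 : x ∈ S := by simpa using hx 0 (Nat.succ_pos n)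
    refine norm_mul_le_pow_succ' (ih (x.shift μ) fun t ht => ?_) (hKi μ x h0)
    have := hx (t + 1) (by omega)
    rwa [Function.iterate_succ_apply] at this

omit [NormedAlgebra ℂ 𝔸] [CompleteSpace 𝔸] in
/-- **BACKWARD CONTOUR OF `n` BONDS BASED IN `S`**: the bonds traversed are `U_μ(x − (t+1)e_μ)`, `t < n`; if these base points lie in `S` and `‖U_μ(y)⁻¹‖ ≤ K` on `S`,
then `‖U(Γ)‖ ≤ Kⁿ`. [cite: Balaban1985BackgroundPropagators, (3.3), (3.5) p.391, (3.40) p.397] -/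
theorem norm_parBwdV_le_pow_of_mem (hKi : ∀ μ y, y ∈ S → ‖(((U μ y)⁻¹ : 𝔸ˣ) : 𝔸)‖ ≤ K) (μ : Fin P.d) (n : ℕ) :
    ∀ x : Site P 0, (∀ t, t < n → (fun y : Site P 0 => y.unshift μ)^[t + 1] x ∈ S) → ‖(parBwdV U μ n x : 𝔸)‖ ≤ K ^ n := by
  induction n with
  | zero => intro x _; simp
  | succ n ih =>
    intro x hx
    rw [parBwdV_succ, Units.val_mul]
    have h0 : x.unshift μ ∈ S := by simpa using hx 0 (Nat.succ_pos n)
    refine norm_mul_le_pow_succ (hKi μ _ h0) (ih (x.unshift μ) fun t ht => ?_)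
    have := hx (t + 1) (by omega)
    rwa [Function.iterate_succ_apply] at this

/-- … and `‖U(Γ)⁻¹‖ ≤ Kⁿ` from `‖U_μ(y)‖ ≤ K` on `S`. [cite: Balaban1985BackgroundPropagators, (3.3), (3.5) p.391, (3.40) p.397] -/
theorem norm_parBwdV_inv_le_pow_of_mem (hK : ∀ μ y, y ∈ S → ‖(U μ y : 𝔸)‖ ≤ K) (μ : Fin P.d) (n : ℕ) :
    ∀ x : Site P 0, (∀ t, t < n → (fun y : Site P 0 => y.unshift μ)^[t + 1] x ∈ S) → ‖(((parBwdV U μ n x)⁻¹ : 𝔸ˣ) : 𝔸)‖ ≤ K ^ n := by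
  induction n with
  | zero => intro x _; simp
  | succ n ih =>
    intro x hx
    rw [val_inv_parBwdV_succ]
    have h0 : x.unshift μ ∈ S := by simpa using hx 0 (Nat.succ_pos n)
    refine norm_mul_le_pow_succ' (ih (x.unshift μ) fun t ht => ?_) (hK μ _ h0)
    have := hx (t + 1) (by omega)
    rwa [Function.iterate_succ_apply] at this

end Straight

/-! ## §2. Legs and runs in a taxi-star-shaped region -/

section Taxi

variable (U : CfgV1 P 𝔸) (S : Set (Site P 0)) (x' : Site P 0) {K : ℝ}

omit [NormedAlgebra ℂ 𝔸] [CompleteSpace 𝔸] [NormOneClass 𝔸] in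
/-- **THE LEG's ENDPOINT STAYS IN THE REGION** (taxi-star-shapedness towards `x′`: from every `y ∈ S` the leg towards `x′_μ` the shorter way round stays in `S`,
endpoint included — clauses `hSf` (forward) and `hSb` (backward)). [cite: Balaban1985BackgroundPropagators, (3.40) p.397, bookkeeping] -/
theorem taxiLegV_fst_mem_of_starShaped
    (hSf : ∀ y ∈ S, ∀ (μ : Fin P.d) (t : ℕ), (x' μ - y μ).val ≤ (y μ - x' μ).val → t ≤ (x' μ - y μ).val →
      (fun z : Site P 0 => z.shift μ)^[t] y ∈ S)
    (hSb : ∀ y ∈ S, ∀ (μ : Fin P.d) (t : ℕ), ¬ (x' μ - y μ).val ≤ (y μ - x' μ).val → t ≤ (y μ - x' μ).val →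
      (fun z : Site P 0 => z.unshift μ)^[t] y ∈ S)
    {y : Site P 0} (hy : y ∈ S) (V : 𝔸ˣ) (μ : Fin P.d) : (taxiLegV U x' (y, V) μ).1 ∈ S := by
  unfold taxiLegV
  split_ifs with h
  · exact hSf y hy μ _ h le_rfl
  · exact hSb y hy μ _ h le_rfl

omit [NormedAlgebra ℂ 𝔸] [CompleteSpace 𝔸] in
/-- ★ **ONE LEG IN THE REGION**: `‖(leg from (y,1))‖ ≤ K^{min(fwd, bwd)}` once `‖U_μ(z)^{±1}‖ ≤ K` for `z ∈ S` and `S` is taxi-star-shaped towards `x′`, `y ∈ S`.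
[cite: Balaban1985BackgroundPropagators, (3.40) p.397, (3.3), (3.5) p.391] -/
theorem norm_taxiLegV_le_pow_of_starShaped (hK : ∀ μ y, y ∈ S → ‖(U μ y : 𝔸)‖ ≤ K) (hKi : ∀ μ y, y ∈ S → ‖(((U μ y)⁻¹ : 𝔸ˣ) : 𝔸)‖ ≤ K)
    (hSf : ∀ y ∈ S, ∀ (μ : Fin P.d) (t : ℕ), (x' μ - y μ).val ≤ (y μ - x' μ).val → t ≤ (x' μ - y μ).val →
      (fun z : Site P 0 => z.shift μ)^[t] y ∈ S)
    (hSb : ∀ y ∈ S, ∀ (μ : Fin P.d) (t : ℕ), ¬ (x' μ - y μ).val ≤ (y μ - x' μ).val → t ≤ (y μ - x' μ).val →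
      (fun z : Site P 0 => z.unshift μ)^[t] y ∈ S)
    {y : Site P 0} (hy : y ∈ S) (μ : Fin P.d) :
    ‖((taxiLegV U x' (y, 1) μ).2 : 𝔸)‖ ≤ K ^ min (x' μ - y μ).val (y μ - x' μ).val := by
  unfold taxiLegV
  split_ifs with h
  · rw [min_eq_left h]; simp only [one_mul]
    exact norm_parFwdV_le_pow_of_mem U S hK μ _ y fun t ht => hSf y hy μ t h ht.le
  · rw [min_eq_right (le_of_not_ge h)]; simp only [one_mul]
    exact norm_parBwdV_le_pow_of_mem U S hKi μ _ y fun t ht => hSb y hy μ (t + 1) h ht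

/-- … and its inverse. [cite: Balaban1985BackgroundPropagators, (3.40) p.397, (3.3), (3.5) p.391] -/
theorem norm_taxiLegV_inv_le_pow_of_starShaped (hK : ∀ μ y, y ∈ S → ‖(U μ y : 𝔸)‖ ≤ K) (hKi : ∀ μ y, y ∈ S → ‖(((U μ y)⁻¹ : 𝔸ˣ) : 𝔸)‖ ≤ K)
    (hSf : ∀ y ∈ S, ∀ (μ : Fin P.d) (t : ℕ), (x' μ - y μ).val ≤ (y μ - x' μ).val → t ≤ (x' μ - y μ).val →
      (fun z : Site P 0 => z.shift μ)^[t] y ∈ S)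
    (hSb : ∀ y ∈ S, ∀ (μ : Fin P.d) (t : ℕ), ¬ (x' μ - y μ).val ≤ (y μ - x' μ).val → t ≤ (y μ - x' μ).val →
      (fun z : Site P 0 => z.unshift μ)^[t] y ∈ S)
    {y : Site P 0} (hy : y ∈ S) (μ : Fin P.d) :
    ‖((((taxiLegV U x' (y, 1) μ).2)⁻¹ : 𝔸ˣ) : 𝔸)‖ ≤ K ^ min (x' μ - y μ).val (y μ - x' μ).val := by
  unfold taxiLegV
  split_ifs with h
  · rw [min_eq_left h]; simp only [one_mul]
    exact norm_parFwdV_inv_le_pow_of_mem U S hKi μ _ y fun t ht => hSf y hy μ t h ht.le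
  · rw [min_eq_right (le_of_not_ge h)]; simp only [one_mul]
    exact norm_parBwdV_inv_le_pow_of_mem U S hK μ _ y fun t ht => hSb y hy μ (t + 1) h ht

/-- ★★ **A RUN OVER DISTINCT DIRECTIONS IN THE REGION**: from `(y, 1)`, `y ∈ S`, `‖(run)‖ ≤ K` to the number of its bonds
`Σ_{μ ∈ l} min((x′_μ − y_μ).val, (y_μ − x′_μ).val)` — each leg starts IN `S` (the previous leg's endpoint, `taxiLegV_fst_mem_of_starShaped`) at a point whose
`μ`-coordinate is still `y_μ` (NODE 00's `taxiLegV_fst_apply`). [cite: Balaban1985BackgroundPropagators, (3.3) p.391, (3.40) p.397] -/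
theorem norm_taxiRun_le_pow_of_starShaped (hK : ∀ μ y, y ∈ S → ‖(U μ y : 𝔸)‖ ≤ K) (hKi : ∀ μ y, y ∈ S → ‖(((U μ y)⁻¹ : 𝔸ˣ) : 𝔸)‖ ≤ K)
    (hSf : ∀ y ∈ S, ∀ (μ : Fin P.d) (t : ℕ), (x' μ - y μ).val ≤ (y μ - x' μ).val → t ≤ (x' μ - y μ).val →
      (fun z : Site P 0 => z.shift μ)^[t] y ∈ S)
    (hSb : ∀ y ∈ S, ∀ (μ : Fin P.d) (t : ℕ), ¬ (x' μ - y μ).val ≤ (y μ - x' μ).val → t ≤ (y μ - x' μ).val →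
      (fun z : Site P 0 => z.unshift μ)^[t] y ∈ S)
    (l : List (Fin P.d)) (hl : l.Nodup) :
    ∀ y ∈ S, ‖((taxiRun U x' l (y, 1)).2 : 𝔸)‖ ≤ K ^ (l.map fun μ => min (x' μ - y μ).val (y μ - x' μ).val).sum := by
  induction l with
  | nil => intro y _; simp [taxiRun]
  | cons μ l ih =>
    intro y hy
    have hμ : μ ∉ l := (List.nodup_cons.1 hl).1
    have hl' : l.Nodup := (List.nodup_cons.1 hl).2
    have h := taxiRun_snd_mul_and_fst_eq U U x' l
    simp only [taxiRun] at h
    simp only [taxiRun, List.foldl_cons]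
    rw [show taxiLegV U x' (y, 1) μ = ((taxiLegV U x' (y, 1) μ).1, (taxiLegV U x' (y, 1) μ).2) from rfl, (h _ _ 1).1, Units.val_mul,
      List.map_cons, List.sum_cons, pow_add]
    have hK0 : 0 ≤ K := (norm_nonneg _).trans (hK μ y hy)
    have hy' : (taxiLegV U x' (y, 1) μ).1 ∈ S := taxiLegV_fst_mem_of_starShaped U S x' hSf hSb hy 1 μ
    refine (norm_mul_le _ _).trans (mul_le_mul (norm_taxiLegV_le_pow_of_starShaped U S x' hK hKi hSf hSb hy μ) ?_ (norm_nonneg _) (pow_nonneg hK0 _))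
    refine (ih hl' _ hy').trans (le_of_eq ?_)
    congr 1
    refine congrArg List.sum (List.map_congr_left fun ν hν => ?_)
    have hne : ν ≠ μ := fun h => hμ (h ▸ hν)
    rw [taxiLegV_fst_apply, if_neg hne]

/-- … and the inverse of a run. [cite: Balaban1985BackgroundPropagators, (3.3), (3.5) p.391, (3.40) p.397] -/
theorem norm_taxiRun_inv_le_pow_of_starShaped (hK : ∀ μ y, y ∈ S → ‖(U μ y : 𝔸)‖ ≤ K) (hKi : ∀ μ y, y ∈ S → ‖(((U μ y)⁻¹ : 𝔸ˣ) : 𝔸)‖ ≤ K)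
    (hSf : ∀ y ∈ S, ∀ (μ : Fin P.d) (t : ℕ), (x' μ - y μ).val ≤ (y μ - x' μ).val → t ≤ (x' μ - y μ).val →
      (fun z : Site P 0 => z.shift μ)^[t] y ∈ S)
    (hSb : ∀ y ∈ S, ∀ (μ : Fin P.d) (t : ℕ), ¬ (x' μ - y μ).val ≤ (y μ - x' μ).val → t ≤ (y μ - x' μ).val →
      (fun z : Site P 0 => z.unshift μ)^[t] y ∈ S)
    (l : List (Fin P.d)) (hl : l.Nodup) :
    ∀ y ∈ S, ‖((((taxiRun U x' l (y, 1)).2)⁻¹ : 𝔸ˣ) : 𝔸)‖ ≤ K ^ (l.map fun μ => min (x' μ - y μ).val (y μ - x' μ).val).sum := by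
  induction l with
  | nil => intro y _; simp [taxiRun]
  | cons μ l ih =>
    intro y hy
    have hμ : μ ∉ l := (List.nodup_cons.1 hl).1
    have hl' : l.Nodup := (List.nodup_cons.1 hl).2
    have h := taxiRun_snd_mul_and_fst_eq U U x' l
    simp only [taxiRun] at h
    simp only [taxiRun, List.foldl_cons]
    rw [show taxiLegV U x' (y, 1) μ = ((taxiLegV U x' (y, 1) μ).1, (taxiLegV U x' (y, 1) μ).2) from rfl, (h _ _ 1).1, mul_inv_rev, Units.val_mul,
      List.map_cons, List.sum_cons, add_comm, pow_add]
    have hK0 : 0 ≤ K := (norm_nonneg _).trans (hK μ y hy)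
    have hy' : (taxiLegV U x' (y, 1) μ).1 ∈ S := taxiLegV_fst_mem_of_starShaped U S x' hSf hSb hy 1 μ
    refine (norm_mul_le _ _).trans (mul_le_mul ?_ (norm_taxiLegV_inv_le_pow_of_starShaped U S x' hK hKi hSf hSb hy μ) (norm_nonneg _) (pow_nonneg hK0 _))
    refine (ih hl' _ hy').trans (le_of_eq ?_)
    congr 1
    refine congrArg List.sum (List.map_congr_left fun ν hν => ?_)
    have hne : ν ≠ μ := fun h => hμ (h ▸ hν)
    rw [taxiLegV_fst_apply, if_neg hne]

/-- ★★★ **THE TAXICAB TRANSPORTER FROM A POINT OF A TAXI-STAR-SHAPED REGION**: `‖U(Γ_{x,x′})‖ ≤ K^{|x − x′|₁}` for `x ∈ S`, `‖U(b)^{±1}‖ ≤ K` on the bonds based in `S`.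
[cite: Balaban1985BackgroundPropagators, (3.3) p.391, (3.40) p.397, (3.35)–(3.37) p.396; Balaban1985Averaging, (52)–(55) pp.27–28] -/
theorem norm_parTaxiV_le_pow_of_starShaped (hK : ∀ μ y, y ∈ S → ‖(U μ y : 𝔸)‖ ≤ K) (hKi : ∀ μ y, y ∈ S → ‖(((U μ y)⁻¹ : 𝔸ˣ) : 𝔸)‖ ≤ K)
    (hSf : ∀ y ∈ S, ∀ (μ : Fin P.d) (t : ℕ), (x' μ - y μ).val ≤ (y μ - x' μ).val → t ≤ (x' μ - y μ).val →
      (fun z : Site P 0 => z.shift μ)^[t] y ∈ S)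
    (hSb : ∀ y ∈ S, ∀ (μ : Fin P.d) (t : ℕ), ¬ (x' μ - y μ).val ≤ (y μ - x' μ).val → t ≤ (y μ - x' μ).val →
      (fun z : Site P 0 => z.unshift μ)^[t] y ∈ S)
    {x : Site P 0} (hx : x ∈ S) : ‖(parTaxiV U x x' : 𝔸)‖ ≤ K ^ Site.tdist x x' := by
  rw [← sum_finRange_min_eq_tdist]
  exact norm_taxiRun_le_pow_of_starShaped U S x' hK hKi hSf hSb _ (List.nodup_finRange _) x hx

/-- ★★★ **… AND ITS INVERSE**: `‖U(Γ_{x,x′})⁻¹‖ ≤ K^{|x − x′|₁}` for `x ∈ S`. [cite: Balaban1985BackgroundPropagators, (3.3), (3.5) p.391, (3.40) p.397, (3.35)–(3.37) p.396] -/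
theorem norm_parTaxiV_inv_le_pow_of_starShaped (hK : ∀ μ y, y ∈ S → ‖(U μ y : 𝔸)‖ ≤ K) (hKi : ∀ μ y, y ∈ S → ‖(((U μ y)⁻¹ : 𝔸ˣ) : 𝔸)‖ ≤ K)
    (hSf : ∀ y ∈ S, ∀ (μ : Fin P.d) (t : ℕ), (x' μ - y μ).val ≤ (y μ - x' μ).val → t ≤ (x' μ - y μ).val →
      (fun z : Site P 0 => z.shift μ)^[t] y ∈ S)
    (hSb : ∀ y ∈ S, ∀ (μ : Fin P.d) (t : ℕ), ¬ (x' μ - y μ).val ≤ (y μ - x' μ).val → t ≤ (y μ - x' μ).val →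
      (fun z : Site P 0 => z.unshift μ)^[t] y ∈ S)
    {x : Site P 0} (hx : x ∈ S) : ‖(((parTaxiV U x x')⁻¹ : 𝔸ˣ) : 𝔸)‖ ≤ K ^ Site.tdist x x' := by
  rw [← sum_finRange_min_eq_tdist]
  exact norm_taxiRun_inv_le_pow_of_starShaped U S x' hK hKi hSf hSb _ (List.nodup_finRange _) x hx

end Taxi

/-! ## §3. The global corollary: any configuration with `‖U(b)^{±1}‖ ≤ K` -/

section Global

variable (U : CfgV1 P 𝔸) {K : ℝ}

/-- ★ **`‖U(Γ_{x,x′})‖ ≤ K^{|x − x′|₁}` FOR ANY CONFIGURATION** with `‖U(b)^{±1}‖ ≤ K` (the tree's `norm_parTaxiV_prodCfg_le` is the pencil instance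
`K = K₀e^{|η|R}`). [cite: Balaban1985BackgroundPropagators, (3.3) p.391, (3.40) p.397; Balaban1985Averaging, (52)–(55) pp.27–28] -/
theorem norm_parTaxiV_le_pow (hK : ∀ μ y, ‖(U μ y : 𝔸)‖ ≤ K) (hKi : ∀ μ y, ‖(((U μ y)⁻¹ : 𝔸ˣ) : 𝔸)‖ ≤ K) (x x' : Site P 0) :
    ‖(parTaxiV U x x' : 𝔸)‖ ≤ K ^ Site.tdist x x' :=
  norm_parTaxiV_le_pow_of_starShaped U univ x' (fun μ y _ => hK μ y) (fun μ y _ => hKi μ y) (fun _ _ _ _ _ _ => mem_univ _)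
    (fun _ _ _ _ _ _ => mem_univ _) (mem_univ x)

/-- ★ **… and `‖U(Γ_{x,x′})⁻¹‖ ≤ K^{|x − x′|₁}`**. [cite: Balaban1985BackgroundPropagators, (3.3), (3.5) p.391, (3.40) p.397] -/
theorem norm_parTaxiV_inv_le_pow (hK : ∀ μ y, ‖(U μ y : 𝔸)‖ ≤ K) (hKi : ∀ μ y, ‖(((U μ y)⁻¹ : 𝔸ˣ) : 𝔸)‖ ≤ K) (x x' : Site P 0) :
    ‖(((parTaxiV U x x')⁻¹ : 𝔸ˣ) : 𝔸)‖ ≤ K ^ Site.tdist x x' :=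
  norm_parTaxiV_inv_le_pow_of_starShaped U univ x' (fun μ y _ => hK μ y) (fun μ y _ => hKi μ y) (fun _ _ _ _ _ _ => mem_univ _)
    (fun _ _ _ _ _ _ => mem_univ _) (mem_univ x)

end Global

end Literature.MathematicalPhysics.QuantumFieldTheory.Balaban1983to89.B13TaxiPathBoundsLocal
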